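import Literature.Geometry.Riemannian.KarpukhinSternHarmonicMapsProofs
import Literature.Geometry.Lorentzian.WeakSolutionChart
import Literature.Analysis.Convolution.MollifyC2Approx
import Mathlib.Geometry.Manifold.PartitionOfUnity
import HarnessLib

/-!
# Smooth approximation of a `C²` function on a compact set, in the seminorms `|Δ_g ·|` and
# `|h⁻¹(d ·, da)|`

Topic `Geometry/Riemannian`. Theorem file (no definitions, no named facts; everything proved), on
the discharge path of `Literature.Geometry.Riemannian.sharpLogSobolevAVR_four`: the density of
`C^∞` in `C²` (Hirsch, *Differential Topology*, Thm. 2.2.6; here only the consequence needed —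
for `w ∈ C²(M)`, a compact `K`, finitely many smooth `aₗ` and `ε > 0` there is `u ∈ C^∞(M)` with
`|Δ_g u - Δ_g w| ≤ ε` and `|h⁻¹(du - dw, daₗ)| ≤ ε` on `K`, `exists_contMDiff_approx_operators`).
Proof: a finite smooth partition of unity `χᵢ` near `K` subordinate to chart domains; each
`χᵢ w`, read in its chart and extended by zero, is a compactly supported `C²` function on `ℝᵐ`,
mollified (`MollifyC2Approx.lean`) and pulled back (`WeakSolutionChart.lean`); the coordinate
formulae for `Δ_g` and `h⁻¹` (`ChartLaplacian.lean`) with continuous coefficients bound the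
errors on compact sets (`exists_piece_approx`).

## References

* M. W. Hirsch, *Differential Topology*, GTM 33 (1976), Ch. 2, Thm. 2.6. [Hirsch1976]
* L. C. Evans, *Partial Differential Equations*, 2nd ed. (2010), App. C.4 Theorem 7. [Evans2010]
-/

noncomputable section

open MeasureTheory Measure Set Filter Metric Module InnerProductSpace TopologicalSpace Function
open scoped ENNReal NNReal Manifold ContDiff Topology RealInnerProductSpace Matrix

namespace Literature.Geometry.Riemannian

open Lorentzian Literature.Analysis.Convolution
open Bundle PseudoRiemannianMetric

variable {m : ℕ} {M : Type*} [TopologicalSpace M] [ChartedSpace (EuclideanSpace ℝ (Fin m)) M]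
  [IsManifold (𝓡 m) ∞ M] [T2Space M]
  (h : ContMDiffRiemannianMetric (𝓡 m) ∞ (EuclideanSpace ℝ (Fin m)) (TangentSpace (𝓡 m) : M → Type _))
  [(ofRiemannian h).HasLeviCivita]

/-- Operator-norm bound for a bilinear form evaluated on unit basis vectors. [folklore] -/
theorem abs_apply_single_single_le
    (H : EuclideanSpace ℝ (Fin m) →L[ℝ] EuclideanSpace ℝ (Fin m) →L[ℝ] ℝ) (i j : Fin m) :
    |H (EuclideanSpace.single i 1) (EuclideanSpace.single j 1)| ≤ ‖H‖ := by
  have := H.le_opNorm₂ (EuclideanSpace.single i (1 : ℝ)) (EuclideanSpace.single j (1 : ℝ))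
  have h1 : ‖EuclideanSpace.single i (1 : ℝ)‖ = 1 := by simp
  have h2 : ‖EuclideanSpace.single j (1 : ℝ)‖ = 1 := by simp
  rw [h1, h2, mul_one, mul_one] at this
  rwa [← Real.norm_eq_abs]

/-- Operator-norm bound for a linear form evaluated on a unit basis vector. [folklore] -/
theorem abs_apply_single_le (lam : EuclideanSpace ℝ (Fin m) →L[ℝ] ℝ) (i : Fin m) :
    |lam (EuclideanSpace.single i 1)| ≤ ‖lam‖ := by
  have := lam.le_opNorm (EuclideanSpace.single i (1 : ℝ))
  have h1 : ‖EuclideanSpace.single i (1 : ℝ)‖ = 1 := by simp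
  rw [h1, mul_one] at this
  rwa [← Real.norm_eq_abs]

set_option synthInstance.maxHeartbeats 400000 in
set_option maxHeartbeats 6400000 in
/-- **The local smoothing step** (one chart piece): for `χ ∈ C^∞_c` supported in the chart domain
of `x₀`, `w ∈ C²`, smooth probes `aₗ` and `η > 0` there is `Z ∈ C^∞_c(M)` supported in the chart
domain with `|Δ_g(Z - χw)| ≤ η` and `|h⁻¹(d(Z - χw), daₗ)| ≤ η` everywhere (mollify the chart
representative of `χ w`). [cite: Evans2010, App. C.4 Theorem 7] -/
theorem exists_piece_approx (x₀ : M) {χ : M → ℝ} (hχ : ContMDiff (𝓡 m) 𝓘(ℝ, ℝ) ∞ χ)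
    (hχc : HasCompactSupport χ)
    (hχs : tsupport χ ⊆ (chartAt (EuclideanSpace ℝ (Fin m)) x₀).source) {w : M → ℝ}
    (hw : ContMDiff (𝓡 m) 𝓘(ℝ, ℝ) 2 w) {k : ℕ} {a : Fin k → M → ℝ}
    (ha : ∀ l, ContMDiff (𝓡 m) 𝓘(ℝ, ℝ) ∞ (a l)) {η : ℝ} (hη : 0 < η) :
    ∃ Z : M → ℝ, ContMDiff (𝓡 m) 𝓘(ℝ, ℝ) ∞ Z ∧ HasCompactSupport Z ∧
      tsupport Z ⊆ (chartAt (EuclideanSpace ℝ (Fin m)) x₀).source ∧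
      ∀ x, |(ofRiemannian h).dalembertian (fun y ↦ Z y - χ y * w y) x| ≤ η ∧
        ∀ l, |(ofRiemannian h).innerDual x (mvfderiv (𝓡 m) (fun y ↦ Z y - χ y * w y) x).toLinearMap
          (mvfderiv (𝓡 m) (a l) x).toLinearMap| ≤ η := by
  classical
  set g := ofRiemannian h with hg_def
  -- the standard basis, the chart, the target
  set b : Module.Basis (Fin m) ℝ (EuclideanSpace ℝ (Fin m)) :=
    (EuclideanSpace.basisFun (Fin m) ℝ).toBasis with hb_def
  have hb : ∀ i, b i = EuclideanSpace.single i 1 := fun i ↦ by simp [hb_def]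
  set φ := extChartAt (𝓡 m) x₀ with hφ
  set T : Set (EuclideanSpace ℝ (Fin m)) := φ.target with hT_def
  have hT : IsOpen T := isOpen_extChartAt_target x₀
  have hsrc : (chartAt (EuclideanSpace ℝ (Fin m)) x₀).source = φ.source :=
    (extChartAt_source (I := 𝓡 m) (x := x₀)).symm
  have hmemS : ∀ y ∈ T, φ.symm y ∈ (chartAt (EuclideanSpace ℝ (Fin m)) x₀).source := fun y hy ↦ by
    rw [hsrc]; exact φ.map_target hy
  have hTnhds : ∀ y ∈ T, T ∈ 𝓝 y := fun y hy ↦ hT.mem_nhds hy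
  -- the metric coefficients in the chart
  obtain ⟨Gh, hGh⟩ : ∃ Gh : EuclideanSpace ℝ (Fin m) → Fin m → Fin m → ℝ,
      Gh = fun y i j ↦ chartGramMatrix h x₀ y i j := ⟨_, rfl⟩
  have hofG : ∀ y, Matrix.of (Gh y) = chartGramMatrix h x₀ y := fun y ↦ by rw [hGh]; rfl
  have hGT : ∀ y ∈ T, ∀ i j, Gh y i j = g.val (φ.symm y)
      ((trivializationAt (EuclideanSpace ℝ (Fin m)) (TangentSpace (𝓡 m)) x₀).localFrame b i
        (φ.symm y))
      ((trivializationAt (EuclideanSpace ℝ (Fin m)) (TangentSpace (𝓡 m)) x₀).localFrame b j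
        (φ.symm y)) := by
    intro y hy i j
    rw [hGh]
    exact chartGramMatrix_apply_eq_val_localFrame h x₀ hy i j
  have hGsm : ∀ i j, ContDiffOn ℝ ∞ (fun y ↦ Gh y i j) T := fun i j ↦
    (contDiffOn_gram_comp_extChartAt_symm b g i j).congr (fun y hy ↦ hGT y hy i j)
  have hdetpos : ∀ y ∈ T, 0 < (Matrix.of (Gh y)).det := fun y hy ↦ by
    rw [hofG]
    exact Real.sqrt_pos.1 (sqrt_det_chartGramMatrix_pos h x₀ hy)
  have hGinv : ∀ i l, ContDiffOn ℝ ∞ (fun y ↦ (Matrix.of (Gh y))⁻¹ i l) T := by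
    intro i l y hy
    have h1 := contMDiffAt_matrix_inv (I := 𝓘(ℝ, EuclideanSpace ℝ (Fin m))) (k := ∞)
      (A := fun y ↦ Matrix.of (Gh y)) (x₀ := y)
      (fun i j ↦ contMDiffAt_iff_contDiffAt.2 ((hGsm i j).contDiffAt (hT.mem_nhds hy)))
      (hdetpos y hy).ne' i l
    exact (contMDiffAt_iff_contDiffAt.1 h1).contDiffWithinAt
  -- the Christoffel-type coefficients and the probes in the chart
  set cf : EuclideanSpace ℝ (Fin m) → Fin m → Fin m → Fin m → ℝ := fun y i j l ↦
    ∑ k', 2⁻¹ * (fderiv ℝ (fun z ↦ Gh z j k') y (b i) + fderiv ℝ (fun z ↦ Gh z i k') y (b j) -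
      fderiv ℝ (fun z ↦ Gh z i j) y (b k')) * (Matrix.of (Gh y))⁻¹ k' l with hcf
  have hdG : ∀ i j (v : EuclideanSpace ℝ (Fin m)), ContinuousOn (fun y ↦ fderiv ℝ (fun z ↦ Gh z i j) y v) T :=
    fun i j v ↦ ((hGsm i j).continuousOn_fderiv_of_isOpen hT (by simp)).clm_apply continuousOn_const
  have hcfc : ∀ i j l, ContinuousOn (fun y ↦ cf y i j l) T := fun i j l ↦ by
    simp only [hcf]
    refine continuousOn_finsetSum _ fun k' _ ↦ ?_
    exact ((continuousOn_const.mul (((hdG j k' (b i)).add (hdG i k' (b j))).sub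
      (hdG i j (b k')))).mul (hGinv k' l).continuousOn)
  set ah : Fin k → EuclideanSpace ℝ (Fin m) → ℝ := fun l ↦ a l ∘ φ.symm with hah
  have hah_s : ∀ l, ContDiffOn ℝ ∞ (ah l) T := fun l ↦ contDiffOn_comp_extChartAt_symm (ha l)
  have hdah : ∀ l (v : EuclideanSpace ℝ (Fin m)), ContinuousOn (fun y ↦ fderiv ℝ (ah l) y v) T :=
    fun l v ↦ ((hah_s l).continuousOn_fderiv_of_isOpen hT (by simp)).clm_apply continuousOn_const
  -- the bounding functions
  set B₁ : EuclideanSpace ℝ (Fin m) → ℝ := fun y ↦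
    ∑ i, ∑ j, |(Matrix.of (Gh y))⁻¹ i j| * (1 + ∑ l, |cf y i j l|) with hB₁
  set B₂ : EuclideanSpace ℝ (Fin m) → ℝ := fun y ↦
    ∑ l, ∑ i, ∑ j, |(Matrix.of (Gh y))⁻¹ i j| * |fderiv ℝ (ah l) y (b j)| with hB₂
  have hB₁c : ContinuousOn B₁ T := by
    simp only [hB₁]
    refine continuousOn_finsetSum _ fun i _ ↦ continuousOn_finsetSum _ fun j _ ↦ ?_
    exact ((hGinv i j).continuousOn.abs).mul
      (continuousOn_const.add (continuousOn_finsetSum _ fun l _ ↦ (hcfc i j l).abs))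
  have hB₂c : ContinuousOn B₂ T := by
    simp only [hB₂]
    refine continuousOn_finsetSum _ fun l _ ↦ continuousOn_finsetSum _ fun i _ ↦
      continuousOn_finsetSum _ fun j _ ↦ ?_
    exact ((hGinv i j).continuousOn.abs).mul ((hdah l (b j)).abs)
  have hB₁nn : ∀ y, 0 ≤ B₁ y := fun y ↦ Finset.sum_nonneg fun i _ ↦ Finset.sum_nonneg fun j _ ↦
    mul_nonneg (abs_nonneg _) (by positivity)
  have hB₂nn : ∀ y, 0 ≤ B₂ y := fun y ↦ Finset.sum_nonneg fun l _ ↦ Finset.sum_nonneg fun i _ ↦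
    Finset.sum_nonneg fun j _ ↦ mul_nonneg (abs_nonneg _) (abs_nonneg _)
  -- the compact sets: `S = tsupport χ`, `C = φ(S) ⊆ T`, `C ⊆ interior L`, `L ⊆ T`
  set S : Set M := tsupport χ with hS
  have hSc : IsCompact S := hχc
  have hSsrc : S ⊆ φ.source := by rw [← hsrc]; exact hχs
  set C : Set (EuclideanSpace ℝ (Fin m)) := φ '' S with hC
  have hCc : IsCompact C := hSc.image_of_continuousOn ((continuousOn_extChartAt x₀).mono hSsrc)
  have hCT : C ⊆ T := by
    rintro _ ⟨p, hp, rfl⟩; exact φ.map_source (hSsrc hp)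
  obtain ⟨L, hLc, hCL, hLT⟩ := exists_compact_between hCc hT hCT
  -- the bound on `L`
  obtain ⟨Λ₀, hΛ₀⟩ := hLc.exists_bound_of_continuousOn ((hB₁c.add hB₂c).mono hLT)
  set Λ : ℝ := |Λ₀| + 1 with hΛ
  have hΛpos : 0 < Λ := by positivity
  have hBL : ∀ y ∈ L, B₁ y ≤ Λ ∧ B₂ y ≤ Λ := fun y hy ↦ by
    have h1 := hΛ₀ y hy
    rw [Real.norm_eq_abs] at h1
    have h2 : B₁ y + B₂ y ≤ Λ₀ := (le_abs_self (B₁ y + B₂ y)).trans h1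
    exact ⟨by linarith [hB₂nn y, le_abs_self Λ₀], by linarith [hB₁nn y, le_abs_self Λ₀]⟩
  set η' : ℝ := η / Λ with hη'
  have hη'pos : 0 < η' := by positivity
  have hΛη : Λ * η' = η := by rw [hη']; field_simp
  /- the chart representative `V` of `χ w`, extended by zero -/
  set V : EuclideanSpace ℝ (Fin m) → ℝ := T.indicator ((fun y ↦ χ y * w y) ∘ φ.symm) with hV
  have hχw2 : ContMDiff (𝓡 m) 𝓘(ℝ, ℝ) 2 fun y ↦ χ y * w y := (hχ.of_le (by norm_cast)).mul hw
  have hVon : ContDiffOn ℝ 2 ((fun y ↦ χ y * w y) ∘ φ.symm) T := contDiffOn_comp_extChartAt_symm hχw2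
  have hVT : ∀ y ∈ T, V y = χ (φ.symm y) * w (φ.symm y) := fun y hy ↦ by
    rw [hV, indicator_of_mem hy]; rfl
  have hV0 : ∀ y ∉ C, V y = 0 := by
    intro y hyC
    by_cases hyT : y ∈ T
    · rw [hVT y hyT]
      have : φ.symm y ∉ S := fun hmem ↦ hyC ⟨_, hmem, φ.right_inv hyT⟩
      rw [image_eq_zero_of_notMem_tsupport this, zero_mul]
    · rw [hV, indicator_of_notMem hyT]
  have hV2 : ContDiff ℝ 2 V :=
    contDiff_of_contDiffOn_of_eq_zero hT hCc hCT (hVon.congr fun y hy ↦ hVT y hy) hV0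
  have hVsupp : tsupport V ⊆ C :=
    closure_minimal (fun y hy ↦ by_contra fun hyC ↦ hy (hV0 y hyC)) hCc.isClosed
  have hVc : HasCompactSupport V := hCc.of_isClosed_subset (isClosed_tsupport _) hVsupp
  /- mollify -/
  obtain ⟨δ, ζ, hδ, -, hζs, hζc, hζt, hE0, hE1, hE2⟩ :=
    exists_mollify_contDiff_two_approx hV2 hVc hη'pos isOpen_interior (hVsupp.trans hCL)
  have hζT : tsupport ζ ⊆ T := hζt.trans (interior_subset.trans hLT)
  have hζL : tsupport ζ ⊆ L := hζt.trans interior_subset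
  /- pull back -/
  set Z : M → ℝ := (chartAt (EuclideanSpace ℝ (Fin m)) x₀).source.indicator (ζ ∘ φ) with hZ
  have hZs : ContMDiff (𝓡 m) 𝓘(ℝ, ℝ) ∞ Z := contMDiff_indicator_comp_extChartAt (I := 𝓡 m) x₀ hζs hζc hζT
  have hZc : HasCompactSupport Z := hasCompactSupport_indicator_comp_extChartAt (I := 𝓡 m) x₀ hζc hζT
  obtain ⟨hZts, -, hKS⟩ := tsupport_indicator_comp_extChartAt_subset (I := 𝓡 m) x₀ hζc hζT
  have hZsrc : tsupport Z ⊆ (chartAt (EuclideanSpace ℝ (Fin m)) x₀).source := hZts.trans hKS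
  -- the error function `Tf = Z - χ w` and its chart representative `Ef = ζ - V`
  set Tf : M → ℝ := fun y ↦ Z y - χ y * w y with hTf
  have hTf2 : ContMDiff (𝓡 m) 𝓘(ℝ, ℝ) 2 Tf := (hZs.of_le (by norm_cast)).sub hχw2
  have hTf1 : ContMDiff (𝓡 m) 𝓘(ℝ, ℝ) 1 Tf := hTf2.of_le (by norm_cast)
  set Ef : EuclideanSpace ℝ (Fin m) → ℝ := fun y ↦ ζ y - V y with hEf
  have hEf2 : ContDiff ℝ 2 Ef := (hζs.of_le (by norm_cast)).sub hV2
  have hTE : ∀ y ∈ T, Tf (φ.symm y) = Ef y := fun y hy ↦ by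
    simp only [hTf, hEf]
    rw [hZ, indicator_comp_extChartAt_symm_apply (I := 𝓡 m) x₀ ζ hy, hVT y hy]
  -- norms of the `2`-jet of `Ef`
  have hN1 : ∀ y, ‖fderiv ℝ Ef y‖ ≤ η' := fun y ↦ by
    have e : fderiv ℝ Ef y = fderiv ℝ ζ y - fderiv ℝ V y :=
      fderiv_sub ((hζs.differentiable (by simp)) y) ((hV2.differentiable (by norm_cast)) y)
    rw [e]; exact hE1 y
  have hN2 : ∀ y, ‖fderiv ℝ (fderiv ℝ Ef) y‖ ≤ η' := fun y ↦ by
    have e : fderiv ℝ Ef = fun y ↦ fderiv ℝ ζ y - fderiv ℝ V y := funext fun y ↦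
      fderiv_sub ((hζs.differentiable (by simp)) y) ((hV2.differentiable (by norm_cast)) y)
    have e2 : fderiv ℝ (fderiv ℝ Ef) y = fderiv ℝ (fderiv ℝ ζ) y - fderiv ℝ (fderiv ℝ V) y := by
      rw [e]
      exact fderiv_sub (((hζs.fderiv_right (m := ∞) (by norm_cast)).differentiable (by simp)) y)
        (((hV2.fderiv_right (m := 1) (by norm_cast)).differentiable (by norm_cast)) y)
    rw [e2]; exact hE2 y
  -- off `L` the jet of `Ef` vanishes
  have hEf_zero : ∀ y, y ∉ L → fderiv ℝ Ef y = 0 ∧ fderiv ℝ (fderiv ℝ Ef) y = 0 := by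
    intro y hyL
    have hev : Ef =ᶠ[𝓝 y] fun _ ↦ 0 := by
      have h1 : y ∉ tsupport ζ := fun h' ↦ hyL (hζL h')
      have h2 : y ∉ tsupport V := fun h' ↦ hyL ((hVsupp.trans (hCL.trans interior_subset)) h')
      filter_upwards [notMem_tsupport_iff_eventuallyEq.1 h1, notMem_tsupport_iff_eventuallyEq.1 h2]
        with z hz1 hz2
      simp only [hEf, hz1, hz2, Pi.zero_apply, sub_zero]
    have hd1 : fderiv ℝ Ef =ᶠ[𝓝 y] fun _ ↦ 0 := by
      filter_upwards [eventually_eventually_nhds.2 hev] with z hz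
      rw [Filter.EventuallyEq.fderiv_eq (show Ef =ᶠ[𝓝 z] fun _ ↦ 0 from hz)]
      exact fderiv_const_apply (0 : ℝ)
    refine ⟨?_, ?_⟩
    · rw [hev.fderiv_eq]; exact fderiv_const_apply (0 : ℝ)
    · rw [hd1.fderiv_eq]
      exact fderiv_const_apply (0 : EuclideanSpace ℝ (Fin m) →L[ℝ] ℝ)
  /- the estimates -/
  refine ⟨Z, hZs, hZc, hZsrc, fun x ↦ ?_⟩
  by_cases hx : x ∈ (chartAt (EuclideanSpace ℝ (Fin m)) x₀).source
  · -- inside the chart domain: the coordinate formulae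
    have hxs : x ∈ φ.source := hsrc ▸ hx
    have hxT : φ x ∈ T := φ.map_source hxs
    have hleft : φ.symm (φ x) = x := φ.left_inv hxs
    have hfh : Ef =ᶠ[𝓝 (φ x)] Tf ∘ φ.symm := by
      filter_upwards [hTnhds _ hxT] with y hy; exact (hTE y hy).symm
    have hGh_ev : ∀ᶠ z in 𝓝 (φ x), ∀ i j, Gh z i j = g.val (φ.symm z)
        ((trivializationAt (EuclideanSpace ℝ (Fin m)) (TangentSpace (𝓡 m)) x₀).localFrame b i
          (φ.symm z))
        ((trivializationAt (EuclideanSpace ℝ (Fin m)) (TangentSpace (𝓡 m)) x₀).localFrame b j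
          (φ.symm z)) := by
      filter_upwards [hTnhds _ hxT] with z hz; exact hGT z hz
    -- the sizes of the jet at `φ x`
    set N : ℝ := max ‖fderiv ℝ (fderiv ℝ Ef) (φ x)‖ ‖fderiv ℝ Ef (φ x)‖ with hN
    have hN0 : 0 ≤ N := (norm_nonneg (fderiv ℝ Ef (φ x))).trans (le_max_right _ _)
    have hNη : N ≤ η' := max_le (hN2 _) (hN1 _)
    have hH : ∀ i j, |fderiv ℝ (fderiv ℝ Ef) (φ x) (b i) (b j)| ≤ N := fun i j ↦ by
      rw [hb, hb]; exact (abs_apply_single_single_le _ i j).trans (le_max_left _ _)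
    have hlam : ∀ l, |fderiv ℝ Ef (φ x) (b l)| ≤ N := fun l ↦ by
      rw [hb]; exact (abs_apply_single_le _ l).trans (le_max_right _ _)
    -- the key case distinction: on `L` the coefficients are bounded, off `L` the jet vanishes
    have hfinal : ∀ {B : ℝ}, (φ x ∈ L → B ≤ Λ) → 0 ≤ B → B * N ≤ η := by
      intro B hB hB0
      by_cases hxL : φ x ∈ L
      · calc B * N ≤ Λ * η' := mul_le_mul (hB hxL) hNη hN0 hΛpos.le
          _ = η := hΛη
      · have h0 : N = 0 := by
          obtain ⟨h1, h2⟩ := hEf_zero _ hxL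
          have e1 : ‖fderiv ℝ (fderiv ℝ Ef) (φ x)‖ = 0 := by
            rw [h2]; exact ContinuousLinearMap.opNorm_zero
          have e2 : ‖fderiv ℝ Ef (φ x)‖ = 0 := by
            rw [h1]; exact ContinuousLinearMap.opNorm_zero
          rw [hN, e1, e2, max_self]
        rw [h0, mul_zero]; exact hη.le
    refine ⟨?_, fun l ↦ ?_⟩
    · -- the Laplacian
      have hL := dalembertian_eq_sum_localFrame g b hx (hTf2 x) (Gh := Gh) (fh := Ef) hGh_ev hfh
      rw [hL]
      refine le_trans ?_ (hfinal (fun hxL ↦ (hBL _ hxL).1) (hB₁nn (φ x)))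
      calc |∑ i, ∑ j, (Matrix.of (Gh (φ x)))⁻¹ i j *
            (fderiv ℝ (fderiv ℝ Ef) (φ x) (b i) (b j) -
              ∑ l, (∑ k', 2⁻¹ * (fderiv ℝ (fun z ↦ Gh z j k') (φ x) (b i) +
                fderiv ℝ (fun z ↦ Gh z i k') (φ x) (b j) -
                fderiv ℝ (fun z ↦ Gh z i j) (φ x) (b k')) * (Matrix.of (Gh (φ x)))⁻¹ k' l) *
                fderiv ℝ Ef (φ x) (b l))|
          ≤ ∑ i, ∑ j, |(Matrix.of (Gh (φ x)))⁻¹ i j| * (N + ∑ l, |cf (φ x) i j l| * N) := by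
            refine (Finset.abs_sum_le_sum_abs _ _).trans (Finset.sum_le_sum fun i _ ↦ ?_)
            refine (Finset.abs_sum_le_sum_abs _ _).trans (Finset.sum_le_sum fun j _ ↦ ?_)
            rw [abs_mul]
            refine mul_le_mul_of_nonneg_left ?_ (abs_nonneg _)
            refine (abs_sub _ _).trans (add_le_add (hH i j) ?_)
            refine (Finset.abs_sum_le_sum_abs _ _).trans (Finset.sum_le_sum fun l _ ↦ ?_)
            rw [abs_mul]
            exact mul_le_mul_of_nonneg_left (hlam l) (abs_nonneg _)
        _ = B₁ (φ x) * N := by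
            simp only [hB₁, Finset.sum_mul]
            refine Finset.sum_congr rfl fun i _ ↦ Finset.sum_congr rfl fun j _ ↦ ?_
            rw [← Finset.sum_mul]
            ring
    · -- the pairings with the probes
      have hmdT : MDifferentiableAt (𝓡 m) 𝓘(ℝ, ℝ) Tf x := (hTf1 x).mdifferentiableAt one_ne_zero
      have hmda : MDifferentiableAt (𝓡 m) 𝓘(ℝ, ℝ) (a l) x := ((ha l) x).mdifferentiableAt (by simp)
      have hah_ev : ah l =ᶠ[𝓝 (φ x)] a l ∘ φ.symm := Eventually.of_forall fun _ ↦ rfl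
      have hI := innerDual_mvfderiv_eq_sum_localFrame g b hx hmdT hmda (uh := Ef) (vh := ah l)
        hfh hah_ev
      have hmat : (Matrix.of fun i j ↦ g.val x
          ((trivializationAt (EuclideanSpace ℝ (Fin m)) (TangentSpace (𝓡 m)) x₀).localFrame b i x)
          ((trivializationAt (EuclideanSpace ℝ (Fin m)) (TangentSpace (𝓡 m)) x₀).localFrame b j x))
          = Matrix.of (Gh (φ x)) := by
        ext i j
        have := hGT (φ x) hxT i j
        rw [hleft] at this
        simp only [Matrix.of_apply, this]
      rw [hmat] at hI
      rw [hI]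
      have hB₂l : ∑ i, ∑ j, |(Matrix.of (Gh (φ x)))⁻¹ i j| * |fderiv ℝ (ah l) (φ x) (b j)| ≤
          B₂ (φ x) := by
        simp only [hB₂]
        exact Finset.single_le_sum (f := fun l ↦ ∑ i, ∑ j, |(Matrix.of (Gh (φ x)))⁻¹ i j| *
          |fderiv ℝ (ah l) (φ x) (b j)|) (fun l _ ↦ Finset.sum_nonneg fun i _ ↦
            Finset.sum_nonneg fun j _ ↦ mul_nonneg (abs_nonneg _) (abs_nonneg _)) (Finset.mem_univ l)
      refine le_trans ?_ (hfinal (fun hxL ↦ hB₂l.trans (hBL _ hxL).2) (Finset.sum_nonneg fun i _ ↦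
        Finset.sum_nonneg fun j _ ↦ mul_nonneg (abs_nonneg _) (abs_nonneg _)))
      calc |∑ i, ∑ j, (Matrix.of (Gh (φ x)))⁻¹ i j * fderiv ℝ Ef (φ x) (b i) *
            fderiv ℝ (ah l) (φ x) (b j)|
          ≤ ∑ i, ∑ j, |(Matrix.of (Gh (φ x)))⁻¹ i j| * |fderiv ℝ (ah l) (φ x) (b j)| * N := by
            refine (Finset.abs_sum_le_sum_abs _ _).trans (Finset.sum_le_sum fun i _ ↦ ?_)
            refine (Finset.abs_sum_le_sum_abs _ _).trans (Finset.sum_le_sum fun j _ ↦ ?_)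
            rw [abs_mul, abs_mul]
            calc |(Matrix.of (Gh (φ x)))⁻¹ i j| * |fderiv ℝ Ef (φ x) (b i)| *
                  |fderiv ℝ (ah l) (φ x) (b j)|
                = |(Matrix.of (Gh (φ x)))⁻¹ i j| * |fderiv ℝ (ah l) (φ x) (b j)| *
                    |fderiv ℝ Ef (φ x) (b i)| := by ring
              _ ≤ |(Matrix.of (Gh (φ x)))⁻¹ i j| * |fderiv ℝ (ah l) (φ x) (b j)| * N :=
                  mul_le_mul_of_nonneg_left (hlam i) (mul_nonneg (abs_nonneg _) (abs_nonneg _))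
        _ = (∑ i, ∑ j, |(Matrix.of (Gh (φ x)))⁻¹ i j| * |fderiv ℝ (ah l) (φ x) (b j)|) * N := by
            rw [Finset.sum_mul]
            refine Finset.sum_congr rfl fun i _ ↦ ?_
            rw [Finset.sum_mul]
  · -- outside the chart domain: `Tf` vanishes near `x`
    have hxS : x ∉ S := fun h' ↦ hx (hsrc ▸ hSsrc h')
    have hxZ : x ∉ tsupport Z := fun h' ↦ hx (hZsrc h')
    have hev : Tf =ᶠ[𝓝 x] fun _ ↦ 0 := by
      filter_upwards [notMem_tsupport_iff_eventuallyEq.1 hxS, notMem_tsupport_iff_eventuallyEq.1 hxZ]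
        with y hyχ hyZ
      simp only [hTf, hyχ, hyZ, Pi.zero_apply, zero_mul, sub_zero]
    have hΔ0 : g.dalembertian Tf x = 0 := dalembertian_eq_zero_of_eventuallyEq_zero g hev
    have hd0 : mvfderiv (𝓡 m) Tf x = 0 := mvfderiv_eq_zero_of_eventuallyEq_zero hev
    refine ⟨by rw [hΔ0, abs_zero]; exact hη.le, fun l ↦ ?_⟩
    rw [hd0, ContinuousLinearMap.toLinearMap_zero]
    simp only [PseudoRiemannianMetric.innerDual, LinearMap.zero_apply, abs_zero]
    exact hη.le

set_option maxHeartbeats 3200000 in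
/-- **Smooth approximation in the operator seminorms on a compact set** (density of `C^∞` in
`C²`, Hirsch Thm. 2.2.6, in the form needed): for `w ∈ C²(M)`, a compact `K`, smooth probes `aₗ`
and `ε > 0` there is `u ∈ C^∞(M)` with `|Δ_g u - Δ_g w| ≤ ε` and `|h⁻¹(d(u - w), daₗ)| ≤ ε` on
`K`. [cite: Hirsch1976, Ch. 2, Theorem 2.6] -/
theorem exists_contMDiff_approx_operators [SigmaCompactSpace M] {w : M → ℝ}
    (hw : ContMDiff (𝓡 m) 𝓘(ℝ, ℝ) 2 w) {K : Set M} (hK : IsCompact K) {k : ℕ} {a : Fin k → M → ℝ}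
    (ha : ∀ l, ContMDiff (𝓡 m) 𝓘(ℝ, ℝ) ∞ (a l)) {ε : ℝ} (hε : 0 < ε) :
    ∃ u : M → ℝ, ContMDiff (𝓡 m) 𝓘(ℝ, ℝ) ∞ u ∧ ∀ x ∈ K,
      |(ofRiemannian h).dalembertian u x - (ofRiemannian h).dalembertian w x| ≤ ε ∧
      ∀ l, |(ofRiemannian h).innerDual x (mvfderiv (𝓡 m) u x).toLinearMap
          (mvfderiv (𝓡 m) (a l) x).toLinearMap -
        (ofRiemannian h).innerDual x (mvfderiv (𝓡 m) w x).toLinearMap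
          (mvfderiv (𝓡 m) (a l) x).toLinearMap| ≤ ε := by
  classical
  set g := ofRiemannian h with hg_def
  haveI : LocallyCompactSpace M := ChartedSpace.locallyCompactSpace (EuclideanSpace ℝ (Fin m)) M
  /- Step 1: a finite cover of `K` by relatively compact pieces of chart domains -/
  have hO : ∀ x : M, ∃ O : Set M, IsOpen O ∧ x ∈ O ∧ ∃ L : Set M, IsCompact L ∧ O ⊆ L ∧
      L ⊆ (chartAt (EuclideanSpace ℝ (Fin m)) x).source := fun x ↦ by
    obtain ⟨L, hLc, hxL, hLs⟩ := exists_compact_between isCompact_singleton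
      (chartAt (EuclideanSpace ℝ (Fin m)) x).open_source (singleton_subset_iff.2 (mem_chart_source _ x))
    exact ⟨interior L, isOpen_interior, hxL (mem_singleton x), L, hLc, interior_subset, hLs⟩
  choose O hOo hxO L hLc hOL hLs using hO
  obtain ⟨t, hcover⟩ := hK.elim_finite_subcover (fun x : K ↦ O (x : M)) (fun x ↦ hOo (x : M))
    (fun x hx ↦ mem_iUnion.2 ⟨⟨x, hx⟩, hxO x⟩)
  /- Step 2: a partition of unity subordinate to the pieces and `Kᶜ` -/
  set U : Option t → Set M := fun o ↦ Option.elim o Kᶜ (fun i ↦ O ((i : K) : M)) with hU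
  have hUo : ∀ o, IsOpen (U o) := by
    rintro (_ | i)
    · exact hK.isClosed.isOpen_compl
    · exact hOo _
  have hUcov : (univ : Set M) ⊆ ⋃ o, U o := by
    intro x _
    by_cases hx : x ∈ K
    · obtain ⟨i, hi, hxi⟩ := mem_iUnion₂.1 (hcover hx)
      exact mem_iUnion.2 ⟨some ⟨i, hi⟩, hxi⟩
    · exact mem_iUnion.2 ⟨none, hx⟩
  obtain ⟨ρ, hρU⟩ := SmoothPartitionOfUnity.exists_isSubordinate (𝓡 m) isClosed_univ U hUo hUcov
  -- the pieces `χ i = ρ (some i)`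
  have hχs : ∀ i : t, ContMDiff (𝓡 m) 𝓘(ℝ, ℝ) ∞ (ρ (some i)) := fun i ↦ (ρ (some i)).contMDiff
  have hχsupp : ∀ i : t, tsupport (ρ (some i)) ⊆
      (chartAt (EuclideanSpace ℝ (Fin m)) ((i : K) : M)).source :=
    fun i ↦ ((hρU (some i)).trans (hOL _)).trans (hLs _)
  have hχc : ∀ i : t, HasCompactSupport (ρ (some i)) := fun i ↦
    (hLc _).of_isClosed_subset (isClosed_tsupport _) ((hρU (some i)).trans (hOL _))
  /- Step 3: the local smoothings -/
  set η : ℝ := ε / (Fintype.card t + 1) with hη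
  have hη0 : 0 < η := by positivity
  have hpiece := fun i : t ↦ exists_piece_approx h ((i : K) : M) (hχs i) (hχc i) (hχsupp i) hw ha
    hη0
  choose Z hZs hZc hZsrc hZest using hpiece
  /- Step 4: the approximant -/
  set u : M → ℝ := fun x ↦ ∑ i, Z i x with hu
  have hus : ContMDiff (𝓡 m) 𝓘(ℝ, ℝ) ∞ u := contMDiff_finsetSum fun i _ ↦ hZs i
  refine ⟨u, hus, fun x hx ↦ ?_⟩
  /- Step 5: the algebraic decomposition `u = w + S + R` near `x ∈ K` -/
  set Tf : t → M → ℝ := fun i y ↦ Z i y - ρ (some i) y * w y with hTf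
  set S : M → ℝ := fun y ↦ ∑ i, Tf i y with hS
  set R : M → ℝ := fun y ↦ -(ρ none y * w y) with hR
  have hsum1 : ∀ y, ∑ i, ρ (some i) y + ρ none y = 1 := fun y ↦ by
    have h1 := ρ.sum_eq_one (mem_univ y)
    rw [finsum_eq_sum_of_fintype, Fintype.sum_option] at h1
    linarith
  have hdecomp : u = fun y ↦ w y + 1 * (S y + 1 * R y) := by
    funext y
    simp only [hu, hS, hR, hTf, Finset.sum_sub_distrib, one_mul]
    have e : ∑ i, ρ (some i) y * w y = (∑ i, ρ (some i) y) * w y := by rw [Finset.sum_mul]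
    rw [e]
    have h2 : (∑ i, ρ (some i) y) * w y + ρ none y * w y = w y := by
      rw [← add_mul, hsum1 y, one_mul]
    linarith
  have hw2 : ∀ y, ContMDiffAt (𝓡 m) 𝓘(ℝ, ℝ) 2 w y := fun y ↦ hw y
  have hTf2 : ∀ i, ContMDiff (𝓡 m) 𝓘(ℝ, ℝ) 2 (Tf i) := fun i ↦
    ((hZs i).of_le (by norm_cast)).sub (((hχs i).of_le (by norm_cast)).mul hw)
  have hS2 : ContMDiff (𝓡 m) 𝓘(ℝ, ℝ) 2 S := contMDiff_finsetSum fun i _ ↦ hTf2 i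
  -- `R` vanishes near `x`
  have hx0 : x ∉ tsupport (ρ none) := fun h' ↦ hρU none h' hx
  have hRev : R =ᶠ[𝓝 x] fun _ ↦ 0 := by
    filter_upwards [notMem_tsupport_iff_eventuallyEq.1 hx0] with y hy
    simp only [hR, hy, Pi.zero_apply, zero_mul, neg_zero]
  have hR2 : ContMDiffAt (𝓡 m) 𝓘(ℝ, ℝ) 2 R x :=
    (contMDiffAt_const (c := (0 : ℝ))).congr_of_eventuallyEq hRev
  have hSR2 : ContMDiffAt (𝓡 m) 𝓘(ℝ, ℝ) 2 (fun y ↦ S y + 1 * R y) x :=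
    (hS2 x).add (contMDiffAt_const.mul hR2)
  have hcard : (Fintype.card t : ℝ) * η ≤ ε := by
    rw [hη, mul_div_assoc']
    rw [div_le_iff₀ (by positivity)]
    nlinarith [hε.le]
  refine ⟨?_, fun l ↦ ?_⟩
  · /- the Laplacian -/
    have e1 : g.dalembertian u x = g.dalembertian w x + 1 * g.dalembertian (fun y ↦ S y + 1 * R y) x := by
      rw [hdecomp]; exact dalembertian_add_const_mul g 1 (hw2 x) hSR2
    have e2 : g.dalembertian (fun y ↦ S y + 1 * R y) x = g.dalembertian S x + 1 * g.dalembertian R x :=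
      dalembertian_add_const_mul g 1 (hS2 x) hR2
    have e3 : g.dalembertian R x = 0 := dalembertian_eq_zero_of_eventuallyEq_zero g hRev
    have e4 : g.dalembertian S x = ∑ i, g.dalembertian (Tf i) x :=
      KarpukhinStern.dalembertian_finset_sum g _ fun i _ ↦ hTf2 i x
    rw [e1, e2, e3, e4, mul_zero, add_zero, one_mul, add_sub_cancel_left]
    refine (Finset.abs_sum_le_sum_abs _ _).trans ?_
    calc ∑ i, |g.dalembertian (Tf i) x| ≤ ∑ _i : t, η :=
          Finset.sum_le_sum fun i _ ↦ (hZest i x).1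
      _ = (Fintype.card t : ℝ) * η := by simp [Finset.sum_const, nsmul_eq_mul]
      _ ≤ ε := hcard
  · /- the pairings -/
    have hmdS : ∀ i, MDifferentiableAt (𝓡 m) 𝓘(ℝ, ℝ) (Tf i) x := fun i ↦
      (hTf2 i x).mdifferentiableAt (by norm_cast)
    obtain ⟨hSmd, hdS⟩ := mvfderiv_finset_sum (I := 𝓡 m) Finset.univ (F := Tf) (p := x)
      fun i _ ↦ hmdS i
    have hRmd : MDifferentiableAt (𝓡 m) 𝓘(ℝ, ℝ) R x := hR2.mdifferentiableAt (by norm_cast)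
    have hdR : mvfderiv (𝓡 m) R x = 0 := mvfderiv_eq_zero_of_eventuallyEq_zero hRev
    have hSRmd : MDifferentiableAt (𝓡 m) 𝓘(ℝ, ℝ) (fun y ↦ S y + 1 * R y) x :=
      hSR2.mdifferentiableAt (by norm_cast)
    have hdu : mvfderiv (𝓡 m) u x = mvfderiv (𝓡 m) w x + ∑ i, mvfderiv (𝓡 m) (Tf i) x := by
      have e0 : u = (w + fun y ↦ S y + 1 * R y) := by rw [hdecomp]; funext y; simp
      rw [e0, mvfderiv_add ((hw2 x).mdifferentiableAt (by norm_cast)) hSRmd]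
      congr 1
      have e5 : (fun y ↦ S y + 1 * R y) = S + R := by funext y; simp
      rw [e5, mvfderiv_add hSmd hRmd, hdR, add_zero]
      exact hdS
    rw [hdu, ContinuousLinearMap.toLinearMap_add, ContinuousLinearMap.toLinearMap_sum]
    show |((mvfderiv (𝓡 m) w x).toLinearMap + ∑ i, (mvfderiv (𝓡 m) (Tf i) x).toLinearMap)
        (g.sharp x (mvfderiv (𝓡 m) (a l) x).toLinearMap) -
        (mvfderiv (𝓡 m) w x).toLinearMap (g.sharp x (mvfderiv (𝓡 m) (a l) x).toLinearMap)| ≤ ε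
    rw [LinearMap.add_apply, LinearMap.sum_apply, add_sub_cancel_left]
    refine (Finset.abs_sum_le_sum_abs _ _).trans ?_
    calc ∑ i, |(mvfderiv (𝓡 m) (Tf i) x).toLinearMap (g.sharp x (mvfderiv (𝓡 m) (a l) x).toLinearMap)|
        ≤ ∑ _i : t, η := Finset.sum_le_sum fun i _ ↦ (hZest i x).2 l
      _ = (Fintype.card t : ℝ) * η := by simp [Finset.sum_const, nsmul_eq_mul]
      _ ≤ ε := hcard

end Literature.Geometry.Riemannian

end
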